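import Mathlib
import Literature.RingTheory.CohomologyAnnihilator.Basic
import Literature.RingTheory.CohomologyAnnihilator.Localization
import HarnessLib

/-!
# The cohomology annihilator of a cylinder `V[X]` is generated by `X`-free elements

[OURS · L1 w44b · crux `Persistence` stmt-ResolutionOfSingularities-16484, K-v8 kill hunt, «LEMMA U» of
`KILL-HUNT-g3.md`]; NOT a statement of the manuscript under review.

For a commutative algebra `V` over an infinite field `k` and every `n`, the ideal
`caⁿ(V[X]) ⊆ V[X]` is extended from `V`: it contains, with a polynomial, the constants `C (coeff p i)`
of all its coefficients, hence `caⁿ(V[X]) = (caⁿ(V[X]) ∩ V) · V[X]`; the same for `ca = ⋃ₙ caⁿ`.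
So the centre of the canonical tower at a «surface × line» stage is generated by functions on the
surface: no `Xʲ · c` with `c ∉ ca` can occur.

Proof: `caⁿ` is invariant under ring automorphisms (tree: `ringEquiv_apply_mem_…`), in particular
under the `V`-algebra automorphisms `X ↦ a • X` (`a ∈ kˣ`) and `X ↦ X + 1` of `V[X]`
(`Polynomial.algEquivCMulXAddC`). An ideal of `V[X]` stable under all `X ↦ a • X`, `a ∈ k ∖ 0`, contains
the monomials of its members (induction on the degree: `p(aX) - a^d p` kills the top coefficient and
rescales the others by the units `a^i - a^d`, `a` chosen outside the finitely many bad values — this is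
where `k` infinite is used); stability under `X ↦ X + 1` then turns `monomial i c` into
`C c * (X+1)^i`, whose constant monomial is `C c`. Elementary; no finiteness of `V` is needed.
-/

set_option linter.dupNamespace false

namespace Summit.ResolutionOfSingularities.ResolutionOfSingularities.Theorems.HomologicalConductor.PersistenceCylinderCentre

open Polynomial Literature.RingTheory.CohomologyAnnihilator

universe u v

variable {k : Type v} [Field k] {V : Type u} [CommRing V] [Algebra k V]

/-- Coefficients of the rescaled polynomial `p(a·X)`: `coeff (p.comp (C a * X)) i = p.coeff i * a ^ i`. -/
theorem coeff_comp_C_mul_X (p : V[X]) (a : V) (i : ℕ) :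
    (p.comp (C a * X)).coeff i = p.coeff i * a ^ i := by
  induction p using Polynomial.induction_on' with
  | add p q hp hq => simp only [add_comp, coeff_add, hp, hq, add_mul]
  | monomial n c =>
    rw [monomial_comp, mul_pow, ← C_pow, ← mul_assoc, ← C_mul, C_mul_X_pow_eq_monomial,
      coeff_monomial, coeff_monomial]
    split_ifs with h
    · subst h; ring
    · simp

/-- In an infinite field there is a nonzero element none of whose first `d` powers is `1`. -/
theorem exists_ne_zero_pow_ne_one [Infinite k] (d : ℕ) :
    ∃ a : k, a ≠ 0 ∧ ∀ m, 1 ≤ m → m ≤ d → a ^ m ≠ 1 := by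
  classical
  -- the bad elements are roots of the nonzero polynomial `X * ∏_{m=1}^{d} (X^m - 1)`
  let f : k[X] := X * ∏ m ∈ Finset.Icc 1 d, (X ^ m - 1)
  have hf : f ≠ 0 := by
    refine mul_ne_zero X_ne_zero (Finset.prod_ne_zero_iff.mpr fun m hm => ?_)
    have h1 : 1 ≤ m := (Finset.mem_Icc.mp hm).1
    have h := X_pow_sub_C_ne_zero (R := k) (n := m) (by omega) 1
    simpa using h
  obtain ⟨a, ha⟩ := Infinite.exists_notMem_finset f.roots.toFinset
  refine ⟨a, ?_, ?_⟩
  · intro h0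
    apply ha
    rw [Multiset.mem_toFinset, mem_roots hf]
    simp [f, h0]
  · intro m h1 hmd hm
    apply ha
    rw [Multiset.mem_toFinset, mem_roots hf]
    have : (X ^ m - 1 : k[X]).IsRoot a := by simp [hm]
    simp only [f, IsRoot.def, eval_mul, eval_X, eval_prod]
    apply mul_eq_zero_of_right
    exact Finset.prod_eq_zero (Finset.mem_Icc.mpr ⟨h1, hmd⟩) (by simpa using this)

/-- An ideal of `V[X]` stable under the rescalings `X ↦ (algebraMap k V a) • X`, `a ∈ k ∖ 0`, `k` an
infinite field, contains the monomials of its members. -/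
theorem monomial_coeff_mem_of_comp_C_mul_X_mem [Infinite k] (I : Ideal V[X])
    (hI : ∀ a : k, a ≠ 0 → ∀ p ∈ I, p.comp (C (algebraMap k V a) * X) ∈ I) :
    ∀ (d : ℕ) (p : V[X]), p ∈ I → p.natDegree ≤ d → ∀ i, monomial i (p.coeff i) ∈ I := by
  intro d
  induction d with
  | zero =>
    intro p hp hd i
    rcases Nat.eq_zero_or_pos i with rfl | hi
    · have : monomial 0 (p.coeff 0) = p := by
        rw [monomial_zero_left]; exact (eq_C_of_natDegree_le_zero hd).symm
      rwa [this]
    · rw [coeff_eq_zero_of_natDegree_lt (by omega), map_zero]; exact I.zero_mem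
  | succ d ih =>
    intro p hp hd i
    obtain ⟨a, ha0, hapow⟩ := exists_ne_zero_pow_ne_one (k := k) (d + 1)
    set l : V := algebraMap k V a with hl
    -- q := p(aX) - a^(d+1) p has degree ≤ d and lies in I
    set q : V[X] := p.comp (C l * X) - C (l ^ (d + 1)) * p with hq
    have hqI : q ∈ I := I.sub_mem (hI a ha0 p hp) (I.mul_mem_left _ hp)
    have hqcoeff : ∀ j, q.coeff j = p.coeff j * (l ^ j - l ^ (d + 1)) := by
      intro j
      simp only [hq, coeff_sub, coeff_comp_C_mul_X, coeff_C_mul]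
      ring
    have hqdeg : q.natDegree ≤ d := by
      rw [natDegree_le_iff_coeff_eq_zero]
      intro j hj
      rw [hqcoeff]
      rcases Nat.lt_or_ge (d + 1) j with hlt | hge
      · rw [coeff_eq_zero_of_natDegree_lt (lt_of_le_of_lt hd hlt), zero_mul]
      · have : j = d + 1 := by omega
        subst this; simp
    -- for j ≤ d the factor `l^j - l^(d+1)` is a unit (image of a nonzero element of `k`)
    have hmon_low : ∀ j, j ≤ d → monomial j (p.coeff j) ∈ I := by
      intro j hj
      have hm := ih q hqI hqdeg j
      rw [hqcoeff] at hm
      have hunit : IsUnit (l ^ j - l ^ (d + 1)) := by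
        have : l ^ j - l ^ (d + 1) = algebraMap k V (a ^ j - a ^ (d + 1)) := by
          simp [hl, map_sub, map_pow]
        rw [this]
        refine (IsUnit.mk0 _ ?_).map (algebraMap k V)
        intro h
        have hj' : a ^ (d + 1 - j) = 1 := by
          have e : a ^ (d + 1) = a ^ j * a ^ (d + 1 - j) := by
            rw [← pow_add]; congr 1; omega
          have haj : a ^ (d + 1) ≠ 0 := pow_ne_zero _ ha0
          rw [sub_eq_zero] at h
          rw [h] at e
          exact (mul_right_eq_self₀.mp e.symm).resolve_right haj
        exact hapow (d + 1 - j) (by omega) (by omega) hj'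
      obtain ⟨w, hw⟩ := hunit
      have : monomial j (p.coeff j) = C (↑w⁻¹ : V) * monomial j (p.coeff j * (l ^ j - l ^ (d + 1))) := by
        rw [C_mul_monomial, ← hw]
        congr 1
        rw [mul_comm (↑w⁻¹ : V), mul_assoc, Units.mul_inv, mul_one]
      rw [this]
      exact I.mul_mem_left _ hm
    rcases Nat.lt_or_ge d i with hlt | hge
    · rcases Nat.lt_or_ge (d + 1) i with hlt' | hge'
      · rw [coeff_eq_zero_of_natDegree_lt (lt_of_le_of_lt hd hlt'), map_zero]; exact I.zero_mem
      · -- i = d + 1: the top monomial is p minus the lower ones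
        have hi : i = d + 1 := by omega
        subst hi
        have hsum : p = ∑ j ∈ Finset.range (d + 1 + 1), monomial j (p.coeff j) :=
          as_sum_range' p (d + 1 + 1) (by omega)
        have : monomial (d + 1) (p.coeff (d + 1)) = p - ∑ j ∈ Finset.range (d + 1), monomial j (p.coeff j) := by
          rw [Finset.sum_range_succ] at hsum
          rw [eq_sub_iff_add_eq, add_comm, ← hsum]
        rw [this]
        refine I.sub_mem hp (I.sum_mem fun j hj => hmon_low j ?_)
        exact Nat.lt_succ_iff.mp (Finset.mem_range.mp hj)
    · exact hmon_low i hge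

/-- An ideal of `V[X]` stable under `X ↦ a X` (`a ∈ k ∖ 0`) and under `X ↦ X + 1` is extended from `V`:
it contains the constants `C (p.coeff i)` of its members. -/
theorem C_coeff_mem_of_stable [Infinite k] (I : Ideal V[X])
    (hI : ∀ a : k, a ≠ 0 → ∀ p ∈ I, p.comp (C (algebraMap k V a) * X) ∈ I)
    (hT : ∀ p ∈ I, p.comp (X + 1) ∈ I) (p : V[X]) (hp : p ∈ I) (i : ℕ) :
    C (p.coeff i) ∈ I := by
  have hm : monomial i (p.coeff i) ∈ I := monomial_coeff_mem_of_comp_C_mul_X_mem I hI _ p hp le_rfl i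
  have ht : (monomial i (p.coeff i)).comp (X + 1) ∈ I := hT _ hm
  have h0 := monomial_coeff_mem_of_comp_C_mul_X_mem I hI _ _ ht le_rfl 0
  rw [monomial_zero_left] at h0
  have : ((monomial i (p.coeff i)).comp (X + 1)).coeff 0 = p.coeff i := by
    rw [monomial_comp, coeff_C_mul, coeff_zero_eq_eval_zero]
    simp
  rwa [this] at h0

/-- **LEMMA U (degree `n`).** Over an infinite field `k`, for every commutative `k`-algebra `V`, the degree-`n`
cohomology annihilator of the polynomial ring `V[X]` contains, with `p`, the constant polynomials on all
coefficients of `p`. -/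
theorem C_coeff_mem_cohomologyAnnihilatorOfDegree [Infinite k] {n : ℕ} {p : V[X]}
    (hp : p ∈ cohomologyAnnihilatorOfDegree V[X] n) (i : ℕ) :
    C (p.coeff i) ∈ cohomologyAnnihilatorOfDegree V[X] n := by
  refine C_coeff_mem_of_stable (k := k) _ ?_ ?_ p hp i
  · intro a ha q hq
    haveI : Invertible (algebraMap k V a) := (invertibleOfNonzero ha).map (algebraMap k V)
    have h := ringEquiv_apply_mem_cohomologyAnnihilatorOfDegree
      (algEquivCMulXAddC (algebraMap k V a) (0 : V)).toRingEquiv hq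
    simpa [comp_eq_aeval] using h
  · intro q hq
    haveI : Invertible (1 : V) := invertibleOne
    have h := ringEquiv_apply_mem_cohomologyAnnihilatorOfDegree
      (algEquivCMulXAddC (1 : V) (1 : V)).toRingEquiv hq
    simpa [comp_eq_aeval] using h

/-- **LEMMA U (ideal form).** `caⁿ(V[X])` is the extension of its contraction to `V`:
`caⁿ(V[X]) = (C⁻¹ caⁿ(V[X])) · V[X]`. -/
theorem cohomologyAnnihilatorOfDegree_eq_map_comap_C [Infinite k] (n : ℕ) :
    cohomologyAnnihilatorOfDegree V[X] n =
      ((cohomologyAnnihilatorOfDegree V[X] n).comap (C : V →+* V[X])).map C := by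
  have : Nonempty (Algebra k V) := ⟨inferInstance⟩
  refine le_antisymm (fun p hp => ?_) Ideal.map_comap_le
  rw [as_sum_range p]
  refine Ideal.sum_mem _ fun i _ => ?_
  rw [← C_mul_X_pow_eq_monomial]
  exact Ideal.mul_mem_right _ _ (Ideal.mem_map_of_mem _
    (Ideal.mem_comap.mpr (C_coeff_mem_cohomologyAnnihilatorOfDegree (k := k) hp i)))

/-- **LEMMA U for `ca = ⋃ₙ caⁿ`.** -/
theorem C_coeff_mem_cohomologyAnnihilator [Infinite k] {p : V[X]}
    (hp : p ∈ cohomologyAnnihilator V[X]) (i : ℕ) :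
    C (p.coeff i) ∈ cohomologyAnnihilator V[X] := by
  have : Nonempty (Algebra k V) := ⟨inferInstance⟩
  rw [mem_cohomologyAnnihilator_iff] at hp ⊢
  obtain ⟨n, hn⟩ := hp
  exact ⟨n, C_coeff_mem_cohomologyAnnihilatorOfDegree (k := k) hn i⟩

end Summit.ResolutionOfSingularities.ResolutionOfSingularities.Theorems.HomologicalConductor.PersistenceCylinderCentre
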